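import Literature.Geometry.Riemannian.L2HarmonicOneFormsFinite
import Literature.Geometry.Riemannian.L2HarmonicOneFormsVanishing
import Literature.Geometry.Riemannian.OneFormPullback
import Literature.Geometry.Riemannian.IsometryTransportSobolev
import Literature.Geometry.Riemannian.IsometryGeodesicCompleteness
import Literature.Geometry.Riemannian.RicciDeTurckNaturality
import Literature.Geometry.Lorentzian.CurvatureNaturality
import Literature.Geometry.Manifold.BoundarylessRechart
import HarnessLib

/-!
# `L²` harmonic `1`-forms under isometries; finiteness of `ℋ¹` over an arbitrary real model
(Carron's memoir, Thm. 4.3, `k = 1`, first assertion)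

Eighth layer of the proof programme of the named fact
`Literature.Geometry.Riemannian.Carron1999_finrank_l2HarmonicOneForms_le`. The finiteness theorem
`module_finite_l2HarmonicOneForms` (`L2HarmonicOneFormsFinite.lean`) is stated for connected
manifolds charted on `EuclideanSpace ℝ (Fin m)`; the fact quantifies over manifolds without
boundary over an arbitrary finite-dimensional real model `I : ModelWithCorners ℝ E H`. Here the
theorem is transported along isometries (O'Neill 1983, Ch. 3, Prop. 3.59: an isometry preserves
the Levi-Civita connection, hence curvature, `∇α`, `d`, `δ`, and the Riemannian measure):

* `IsIsometry.normSq_ricci_comp` — `|Ric_{hN}|²(u) = |Ric_h|²(Φ u)` for an isometry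
  `Φ : (N, hN) → (M, h)`; `IsIsometry.lintegral_normSq_ricci_rpow_comp` — hence
  `∫ |Ric_{hN}|^{p/2} dV_{hN} = ∫ |Ric_h|^{p/2} dV_h`;
* `IsIsometry.pullback_mem_l2HarmonicOneForms` — **`Φ^*` maps `ℋ¹(M, h)` into `ℋ¹(N, hN)`**
  (smoothness and naturality of `∇` from `OneFormPullback.lean`, the inverse metrics correspond
  on pulled-back covectors, the measures correspond);
* `IsIsometry.module_finite_l2HarmonicOneForms` — `Φ^* : ℋ¹(M, h) → ℋ¹(N, hN)` is linear and
  injective, so `dim ℋ¹(N, hN) < ∞ ⇒ dim ℋ¹(M, h) < ∞`;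
* `module_finite_l2HarmonicOneForms_of_boundarylessManifold` — **Carron's finiteness theorem over
  an arbitrary real model**: a connected complete Riemannian manifold without boundary satisfying
  `(S_p)` (`p > 2`, `μ > 0`) with `∫ |Ric|^{p/2} < ∞` has `dim ℋ¹ < ∞` (recharting over `ℝ^m`,
  `BoundarylessRechart.lean`, and the items above).

* `IsIsometry.l2HarmonicOneForms_eq_bot`,
  `l2HarmonicOneForms_eq_bot_of_small_ricci_of_boundarylessManifold` — the same transport for the
  vanishing theorem (memoir Prop. 4.2, `k = 1`): `‖Ric‖_{L^{p/2}} ≤ μ/16 ⇒ ℋ¹ = 0` over an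
  arbitrary real model.

Everything is proved; no definitions, no named facts (D-0026). The linear dimension bound of
Thm. 4.3 is not addressed.

## References

* G. Carron, *Formes harmoniques L² sur les variétés riemanniennes non-compactes*, mémoire
  d'habilitation (1999) = Rend. Mat. Appl. (7) 21 (2001), §4.b, Thm. 4.3. [`Carron1999HdR`]
* G. Carron, *L²-cohomologie et inégalités de Sobolev*, Math. Ann. 314 (1999) 613–639.
  [`Carron1999`]
* B. O'Neill, *Semi-Riemannian geometry*, Academic Press 1983, Ch. 3, Prop. 3.59, pp. 90–91.
  [`ONeill1983`]
-/

noncomputable section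

open Bundle Set Function Filter Topology MeasureTheory Manifold
open scoped Manifold ContDiff ENNReal NNReal

namespace Literature.Geometry.Riemannian

open Literature.Geometry.Lorentzian
open Literature.Geometry.Lorentzian.PseudoRiemannianMetric

section Isometry

variable {E : Type*} [NormedAddCommGroup E] [NormedSpace ℝ E] {H : Type*} [TopologicalSpace H]
  {I : ModelWithCorners ℝ E H} {M : Type*} [TopologicalSpace M] [ChartedSpace H M]
  [IsManifold I ∞ M]
  {E' : Type*} [NormedAddCommGroup E'] [NormedSpace ℝ E'] {H' : Type*} [TopologicalSpace H']
  {I' : ModelWithCorners ℝ E' H'} {N : Type*} [TopologicalSpace N] [ChartedSpace H' N]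
  [IsManifold I' ∞ N]
  [FiniteDimensional ℝ E] [FiniteDimensional ℝ E']
  {Φ : Diffeomorph I' I N M ∞}
  {hN : ContMDiffRiemannianMetric I' ∞ E' (TangentSpace I' : N → Type _)}
  {h : ContMDiffRiemannianMetric I ∞ E (TangentSpace I : M → Type _)}

/-! ### Curvature -/

/-- **`|Ric|²` is an isometry invariant**: for an isometry `Φ : (N, hN) → (M, h)`,
`|Ric_{hN}|²_{hN}(u) = |Ric_h|²_h(Φ u)` (`hN = Φ^*h` by `IsIsometry.eq_comap`; the Ricci tensor
of the pullback metric is the pullback of the Ricci tensor, `ricci_comap_apply`, and the metric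
square norm is natural, `normSq_comap_eq`). O'Neill 1983, Ch. 3, Prop. 3.59.
[cite: ONeill1983, Ch. 3, Prop. 3.59] -/
theorem _root_.Literature.Geometry.Lorentzian.PseudoRiemannianMetric.IsIsometry.normSq_ricci_comp
    (hΦ : IsIsometry (ofRiemannian hN) (ofRiemannian h) Φ)
    (hdim : Module.finrank ℝ E' = Module.finrank ℝ E) [(ofRiemannian hN).HasLeviCivita]
    [(ofRiemannian h).HasLeviCivita] (u : N) :
    (ofRiemannian hN).normSq u ((ofRiemannian hN).ricci u) =
      (ofRiemannian h).normSq (Φ u) ((ofRiemannian h).ricci (Φ u)) := by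
  haveI : CompleteSpace E := FiniteDimensional.complete ℝ E
  haveI : CompleteSpace E' := FiniteDimensional.complete ℝ E'
  have key : ∀ (g' : PseudoRiemannianMetric I' ∞ E' (TangentSpace I' : N → Type _))
      [g'.HasLeviCivita], g' = (ofRiemannian h).comap contMDiff_pullbackBilin_holds Φ
        (contMDiff_infty_add_one Φ.contMDiff)
        (fun y ↦ (Φ.mfderivToContinuousLinearEquiv (by simp) y).injective) hdim →
      g'.normSq u (g'.ricci u) = (ofRiemannian h).normSq (Φ u) ((ofRiemannian h).ricci (Φ u)) := by
    intro g' _ hg'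
    subst hg'
    refine normSq_comap_eq (ofRiemannian h) contMDiff_pullbackBilin_holds
      (contMDiff_infty_add_one Φ.contMDiff)
      (fun y ↦ (Φ.mfderivToContinuousLinearEquiv (by simp) y).injective) hdim u _ _ fun v w ↦ ?_
    exact ricci_comap_apply (ofRiemannian h) contMDiff_pullbackBilin_holds
      (contMDiff_infty_add_one Φ.contMDiff)
      (fun y ↦ (Φ.mfderivToContinuousLinearEquiv (by simp) y).injective) hdim u v w
  exact key _ (hΦ.eq_comap hdim)

variable [T3Space M] [MeasurableSpace M] [BorelSpace M] [T3Space N] [MeasurableSpace N]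
  [BorelSpace N]

/-- **`∫ |Ric|^{p/2}` is an isometry invariant**:
`∫_N (|Ric_{hN}|²)^{p/4} dV_{hN} = ∫_M (|Ric_h|²)^{p/4} dV_h` (`normSq_ricci_comp` and the
correspondence of the Riemannian measures). [cite: ONeill1983, Ch. 3, Prop. 3.59] -/
theorem _root_.Literature.Geometry.Lorentzian.PseudoRiemannianMetric.IsIsometry.lintegral_normSq_ricci_rpow_comp
    (hΦ : IsIsometry (ofRiemannian hN) (ofRiemannian h) Φ)
    (hdim : Module.finrank ℝ E' = Module.finrank ℝ E) [(ofRiemannian hN).HasLeviCivita]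
    [(ofRiemannian h).HasLeviCivita] (p : ℝ) :
    ∫⁻ u, ENNReal.ofReal (((ofRiemannian hN).normSq u ((ofRiemannian hN).ricci u)) ^ (p / 4))
        ∂riemannianMeasure hN =
      ∫⁻ x, ENNReal.ofReal (((ofRiemannian h).normSq x ((ofRiemannian h).ricci x)) ^ (p / 4))
        ∂riemannianMeasure h := by
  rw [← hΦ.measurePreserving.lintegral_comp_emb Φ.toHomeomorph.measurableEmbedding]
  refine lintegral_congr fun u ↦ ?_
  rw [hΦ.normSq_ricci_comp hdim u]

/-! ### `ℋ¹` -/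

/-- **Isometries pull `L²` harmonic `1`-forms back to `L²` harmonic `1`-forms**: for an isometry
`Φ : (N, hN) → (M, h)` and `α ∈ ℋ¹(M, h)`, the form `Φ^*α = (u ↦ α_{Φ u} ∘ dΦ_u)` lies in
`ℋ¹(N, hN)`: it is smooth (`contMDiffAt_oneFormSection_pullback`), `|Φ^*α|²_{hN} = |α|²_h ∘ Φ`
(`innerDual_comp_mfderiv`) has the same integral (the measures correspond), and
`∇^{hN}(Φ^*α) = Φ^*(∇^h α)` (`covDerivOneForm_pullback`) is symmetric and trace-free with `∇^h α`.
O'Neill 1983, Ch. 3, Prop. 3.59. [cite: ONeill1983, Ch. 3, Prop. 3.59] -/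
theorem _root_.Literature.Geometry.Lorentzian.PseudoRiemannianMetric.IsIsometry.pullback_mem_l2HarmonicOneForms
    (hΦ : IsIsometry (ofRiemannian hN) (ofRiemannian h) Φ)
    (hdim : Module.finrank ℝ E' = Module.finrank ℝ E) [(ofRiemannian hN).HasLeviCivita]
    [(ofRiemannian h).HasLeviCivita] {α : Π x : M, TangentSpace I x →L[ℝ] ℝ}
    (hα : α ∈ l2HarmonicOneForms h) :
    (fun u ↦ (α (Φ u)).comp (mfderiv I' I Φ u)) ∈ l2HarmonicOneForms hN := by
  haveI : CompleteSpace E := FiniteDimensional.complete ℝ E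
  haveI : CompleteSpace E' := FiniteDimensional.complete ℝ E'
  obtain ⟨hs, hL2, hsy, htr⟩ := (mem_l2HarmonicOneForms_iff h).1 hα
  have hΦs : ∀ u, ContMDiffAt I' I ∞ Φ u := fun u ↦ Φ.contMDiff u
  -- naturality of `∇α`, transported from the pullback metric to `hN`
  have key : ∀ (g' : PseudoRiemannianMetric I' ∞ E' (TangentSpace I' : N → Type _))
      [g'.HasLeviCivita], g' = (ofRiemannian h).comap contMDiff_pullbackBilin_holds Φ
        (contMDiff_infty_add_one Φ.contMDiff)
        (fun y ↦ (Φ.mfderivToContinuousLinearEquiv (by simp) y).injective) hdim → ∀ u,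
      (g'.covDerivOneForm (fun u ↦ (α (Φ u)).comp (mfderiv I' I Φ u)) u).IsSymm ∧
        g'.trace u (g'.covDerivOneForm (fun u ↦ (α (Φ u)).comp (mfderiv I' I Φ u)) u) = 0 := by
    intro g' _ hg' u
    subst hg'
    refine ⟨isSymm_covDerivOneForm_pullback (ofRiemannian h) contMDiff_pullbackBilin_holds
      (contMDiff_infty_add_one Φ.contMDiff)
      (fun y ↦ (Φ.mfderivToContinuousLinearEquiv (by simp) y).injective) hdim (hs _) (hsy _), ?_⟩
    rw [trace_covDerivOneForm_pullback (ofRiemannian h) contMDiff_pullbackBilin_holds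
      (contMDiff_infty_add_one Φ.contMDiff)
      (fun y ↦ (Φ.mfderivToContinuousLinearEquiv (by simp) y).injective) hdim (hs _)]
    exact htr _
  have key' := key _ (hΦ.eq_comap hdim)
  refine (mem_l2HarmonicOneForms_iff hN).2 ⟨fun u ↦ contMDiffAt_oneFormSection_pullback (hΦs u)
    (hs _), ?_, fun u ↦ (key' u).1, fun u ↦ (key' u).2⟩
  -- the `L²` condition
  have hpt : ∀ u, (ofRiemannian hN).innerDual u
      ((α (Φ u)).comp (mfderiv I' I Φ u)).toLinearMap
      ((α (Φ u)).comp (mfderiv I' I Φ u)).toLinearMap =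
      (ofRiemannian h).innerDual (Φ u) (α (Φ u)).toLinearMap (α (Φ u)).toLinearMap := fun u ↦
    hΦ.innerDual_comp_mfderiv u (α (Φ u)).toLinearMap (α (Φ u)).toLinearMap
  simp_rw [hpt]
  have heq := hΦ.measurePreserving.lintegral_comp_emb Φ.toHomeomorph.measurableEmbedding
    (fun x ↦ ENNReal.ofReal ((ofRiemannian h).innerDual x (α x).toLinearMap (α x).toLinearMap))
  rw [heq]
  exact hL2

/-- **Finiteness of `ℋ¹` transports along isometries**: `Φ^* : ℋ¹(M, h) → ℋ¹(N, hN)` is linear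
and injective (`dΦ_u` is onto and `Φ` is onto), so `dim ℋ¹(N, hN) < ∞` implies
`dim ℋ¹(M, h) < ∞`. [cite: ONeill1983, Ch. 3, Prop. 3.59] -/
theorem _root_.Literature.Geometry.Lorentzian.PseudoRiemannianMetric.IsIsometry.module_finite_l2HarmonicOneForms
    (hΦ : IsIsometry (ofRiemannian hN) (ofRiemannian h) Φ)
    (hdim : Module.finrank ℝ E' = Module.finrank ℝ E) [(ofRiemannian hN).HasLeviCivita]
    [(ofRiemannian h).HasLeviCivita] (hfin : Module.Finite ℝ (l2HarmonicOneForms hN)) :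
    Module.Finite ℝ (l2HarmonicOneForms h) := by
  -- the pullback as a linear map
  set L : l2HarmonicOneForms h →ₗ[ℝ] l2HarmonicOneForms hN :=
    { toFun := fun α ↦ ⟨fun u ↦ ((α : Π x : M, TangentSpace I x →L[ℝ] ℝ) (Φ u)).comp
        (mfderiv I' I Φ u), hΦ.pullback_mem_l2HarmonicOneForms hdim α.2⟩
      map_add' := fun α β ↦ by
        refine Subtype.ext (funext fun u ↦ ?_)
        simp only [Submodule.coe_add, Pi.add_apply, ContinuousLinearMap.add_comp]
      map_smul' := fun c α ↦ by
        refine Subtype.ext (funext fun u ↦ ?_)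
        simp only [Submodule.coe_smul, Pi.smul_apply, ContinuousLinearMap.smul_comp,
          RingHom.id_apply] } with hL
  haveI : FiniteDimensional ℝ (l2HarmonicOneForms hN) := hfin
  refine FiniteDimensional.of_injective (K := ℝ) (V := l2HarmonicOneForms h)
    (V₂ := l2HarmonicOneForms hN) L fun α β hαβ ↦ ?_
  refine Subtype.ext (funext fun x ↦ ?_)
  have hu := congrArg (fun γ : l2HarmonicOneForms hN ↦
    (γ : Π u : N, TangentSpace I' u →L[ℝ] ℝ) (Φ.symm x)) hαβ
  simp only [hL, LinearMap.coe_mk, AddHom.coe_mk] at hu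
  -- `dΦ` at `Φ⁻¹ x` is onto
  have hsurj : Function.Surjective (mfderiv I' I Φ (Φ.symm x)) :=
    (Φ.mfderivToContinuousLinearEquiv (by simp) (Φ.symm x)).surjective
  refine ContinuousLinearMap.ext fun v ↦ ?_
  obtain ⟨w, hw⟩ := hsurj v
  have := congrArg (fun γ : TangentSpace I' (Φ.symm x) →L[ℝ] ℝ ↦ γ w) hu
  simp only [ContinuousLinearMap.coe_comp, Function.comp_apply, hw] at this
  rwa [Φ.apply_symm_apply] at this

end Isometry

/-! ### Carron's finiteness theorem over an arbitrary real model -/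

section General

/-- **Carron 1999HdR, Thm. 4.3 (`k = 1`), finiteness, over an arbitrary real model.** Let `X` be
a connected `C^∞` manifold without boundary over a finite-dimensional real model
`I : ModelWithCorners ℝ E H`, with a smooth complete Riemannian metric `h` satisfying the Sobolev
inequality `(S_p)` (`p > 2`, `μ > 0`) and `∫ |Ric|^{p/2} dV_h < ∞`. Then the space `ℋ¹(X, h)` of
`L²` harmonic `1`-forms is finite dimensional. Proof: for `dim E = 0` all `1`-forms vanish; for
`dim E = m > 0` the recharted copy `N = ExtRechart I e X` over `ℝ^m` with the transported metric
`hN = Φ^*h` (`Φ : N → X` the identity diffeomorphism) is connected, complete, satisfies `(S_p)` and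
has the same `∫ |Ric|^{p/2}`, so `dim ℋ¹(N, hN) < ∞` by `module_finite_l2HarmonicOneForms`, and
`Φ^* : ℋ¹(X, h) → ℋ¹(N, hN)` is injective. [cite: Carron1999HdR, §4.b, Thm. 4.3] -/
theorem module_finite_l2HarmonicOneForms_of_boundarylessManifold
    {E : Type*} [NormedAddCommGroup E] [NormedSpace ℝ E] [FiniteDimensional ℝ E] {H : Type*}
    [TopologicalSpace H] (I : ModelWithCorners ℝ E H) (X : Type*) [TopologicalSpace X]
    [ChartedSpace H X] [IsManifold I ∞ X] [BoundarylessManifold I X] [T3Space X]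
    [SecondCountableTopology X] [MeasurableSpace X] [BorelSpace X] [ConnectedSpace X]
    (h : ContMDiffRiemannianMetric I ∞ E (TangentSpace I : X → Type _))
    [(ofRiemannian h).HasLeviCivita] {p μ : ℝ} (hp : 2 < p) (hμ : 0 < μ)
    (hc : IsGeodesicallyComplete (ofRiemannian h).leviCivita) (hS : HasSobolevInequality h p μ)
    (hRic : ∫⁻ x, ENNReal.ofReal (((ofRiemannian h).normSq x ((ofRiemannian h).ricci x)) ^
        (p / 4)) ∂riemannianMeasure h ≠ ⊤) :
    Module.Finite ℝ (l2HarmonicOneForms h) := by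
  classical
  rcases Nat.eq_zero_or_pos (Module.finrank ℝ E) with hE0 | hEpos
  · -- zero-dimensional: every `1`-form vanishes
    haveI : Subsingleton E := Module.finrank_zero_iff.1 hE0
    have hzero : ∀ α : l2HarmonicOneForms h, α = 0 := fun α ↦ by
      refine Subtype.ext (funext fun x ↦ ContinuousLinearMap.ext fun v ↦ ?_)
      have hv : v = 0 := Subsingleton.elim (α := E) v 0
      rw [hv, map_zero]
      simp
    haveI : Subsingleton (l2HarmonicOneForms h) := ⟨fun a b ↦ (hzero a).trans (hzero b).symm⟩
    exact Module.Finite.of_finite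
  -- recharting over `ℝ^m`, `m = dim E`
  set m : ℕ := Module.finrank ℝ E with hm
  have hdim : Module.finrank ℝ (EuclideanSpace ℝ (Fin m)) = Module.finrank ℝ E := by simp [hm]
  set e : E ≃L[ℝ] EuclideanSpace ℝ (Fin m) := ContinuousLinearEquiv.ofFinrankEq hdim.symm with he
  haveI : IsManifold I 1 X := IsManifold.of_le (n := ∞) (by norm_num)
  set Φ : Diffeomorph 𝓘(ℝ, EuclideanSpace ℝ (Fin m)) I (Literature.Geometry.Manifold.ExtRechart I e X) X ∞ :=
    Literature.Geometry.Manifold.ExtRechart.toOrig with hΦdef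
  obtain ⟨hN, hΦ⟩ := exists_contMDiffRiemannianMetric_isIsometry Φ hdim h
  haveI : Fact ((1 : ℕ∞ω) ≤ ((⊤ : ℕ∞) : ℕ∞ω)) := ⟨by exact_mod_cast le_top⟩
  haveI : CompleteSpace (EuclideanSpace ℝ (Fin m)) := inferInstance
  haveI : (ofRiemannian hN).HasLeviCivita := PseudoRiemannianMetric.hasLeviCivita _
  -- transport of completeness, of `(S_p)` and of the curvature integral
  have hcN : IsGeodesicallyComplete (ofRiemannian hN).leviCivita := hΦ.isGeodesicallyComplete hdim hc
  have hSN : HasSobolevInequality hN p μ := hΦ.hasSobolevInequality hS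
  have hRicN : ∫⁻ u, ENNReal.ofReal (((ofRiemannian hN).normSq u ((ofRiemannian hN).ricci u)) ^
      (p / 4)) ∂riemannianMeasure hN ≠ ⊤ := by
    rw [hΦ.lintegral_normSq_ricci_rpow_comp hdim p]
    exact hRic
  -- finiteness on the recharted copy, transported back
  have hfinN : Module.Finite ℝ (l2HarmonicOneForms hN) :=
    module_finite_l2HarmonicOneForms (J := 𝓘(ℝ, EuclideanSpace ℝ (Fin m))) hN hp hμ hcN hSN hRicN
  exact hΦ.module_finite_l2HarmonicOneForms hdim hfinN

end General

/-! ### The vanishing theorem (memoir Prop. 4.2, `k = 1`) over an arbitrary real model -/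

section VanishingGeneral

variable {E : Type*} [NormedAddCommGroup E] [NormedSpace ℝ E] {H : Type*} [TopologicalSpace H]
  {I : ModelWithCorners ℝ E H} {M : Type*} [TopologicalSpace M] [ChartedSpace H M]
  [IsManifold I ∞ M]
  {E' : Type*} [NormedAddCommGroup E'] [NormedSpace ℝ E'] {H' : Type*} [TopologicalSpace H']
  {I' : ModelWithCorners ℝ E' H'} {N : Type*} [TopologicalSpace N] [ChartedSpace H' N]
  [IsManifold I' ∞ N]
  [FiniteDimensional ℝ E] [FiniteDimensional ℝ E']
  {Φ : Diffeomorph I' I N M ∞}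
  {hN : ContMDiffRiemannianMetric I' ∞ E' (TangentSpace I' : N → Type _)}
  {h : ContMDiffRiemannianMetric I ∞ E (TangentSpace I : M → Type _)}
  [T3Space M] [MeasurableSpace M] [BorelSpace M] [T3Space N] [MeasurableSpace N] [BorelSpace N]

/-- **Vanishing of `ℋ¹` transports along isometries**: `Φ^* : ℋ¹(M, h) → ℋ¹(N, hN)` is injective,
so `ℋ¹(N, hN) = 0 ⇒ ℋ¹(M, h) = 0`. [cite: ONeill1983, Ch. 3, Prop. 3.59] -/
theorem _root_.Literature.Geometry.Lorentzian.PseudoRiemannianMetric.IsIsometry.l2HarmonicOneForms_eq_bot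
    (hΦ : IsIsometry (ofRiemannian hN) (ofRiemannian h) Φ)
    (hdim : Module.finrank ℝ E' = Module.finrank ℝ E) [(ofRiemannian hN).HasLeviCivita]
    [(ofRiemannian h).HasLeviCivita] (hbot : l2HarmonicOneForms hN = ⊥) :
    l2HarmonicOneForms h = ⊥ := by
  rw [Submodule.eq_bot_iff] at hbot ⊢
  intro α hα
  have hβ := hbot _ (hΦ.pullback_mem_l2HarmonicOneForms hdim hα)
  funext x
  have hu := congrFun hβ (Φ.symm x)
  simp only [Pi.zero_apply] at hu
  have hsurj : Function.Surjective (mfderiv I' I Φ (Φ.symm x)) :=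
    (Φ.mfderivToContinuousLinearEquiv (by simp) (Φ.symm x)).surjective
  refine ContinuousLinearMap.ext fun v ↦ ?_
  obtain ⟨w, hw⟩ := hsurj v
  have := congrArg (fun γ : TangentSpace I' (Φ.symm x) →L[ℝ] ℝ ↦ γ w) hu
  simp only [ContinuousLinearMap.coe_comp, Function.comp_apply, hw,
    zero_apply] at this
  rw [Φ.apply_symm_apply] at this
  rw [this, Pi.zero_apply, zero_apply]

end VanishingGeneral

section VanishingBoundaryless

/-- **Carron 1999HdR, Prop. 4.2 (`k = 1`), over an arbitrary real model.** Let `X` be a connected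
`C^∞` manifold without boundary over a finite-dimensional real model, with a smooth complete
Riemannian metric `h` satisfying `(S_p)` (`p > 2`, `μ > 0`) and
`‖|Ric|‖_{L^{p/2}} = (∫ (|Ric|²)^{p/4} dV_h)^{2/p} ≤ μ/16`. Then `ℋ¹(X, h) = 0`
(recharting over `ℝ^m` as in `module_finite_l2HarmonicOneForms_of_boundarylessManifold`, and
`l2HarmonicOneForms_eq_bot_of_small_ricci`). [cite: Carron1999HdR, §4.b, Prop. 4.2] -/
theorem l2HarmonicOneForms_eq_bot_of_small_ricci_of_boundarylessManifold
    {E : Type*} [NormedAddCommGroup E] [NormedSpace ℝ E] [FiniteDimensional ℝ E] {H : Type*}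
    [TopologicalSpace H] (I : ModelWithCorners ℝ E H) (X : Type*) [TopologicalSpace X]
    [ChartedSpace H X] [IsManifold I ∞ X] [BoundarylessManifold I X] [T3Space X]
    [SecondCountableTopology X] [MeasurableSpace X] [BorelSpace X] [ConnectedSpace X]
    (h : ContMDiffRiemannianMetric I ∞ E (TangentSpace I : X → Type _))
    [(ofRiemannian h).HasLeviCivita] {p μ : ℝ} (hp : 2 < p) (hμ : 0 < μ)
    (hc : IsGeodesicallyComplete (ofRiemannian h).leviCivita) (hS : HasSobolevInequality h p μ)
    (hRic : (∫⁻ x, ENNReal.ofReal (((ofRiemannian h).normSq x ((ofRiemannian h).ricci x)) ^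
        (p / 4)) ∂riemannianMeasure h) ^ (2 / p) ≤ ENNReal.ofReal (μ / 16)) :
    l2HarmonicOneForms h = ⊥ := by
  classical
  rcases Nat.eq_zero_or_pos (Module.finrank ℝ E) with hE0 | hEpos
  · -- zero-dimensional: every `1`-form vanishes
    haveI : Subsingleton E := Module.finrank_zero_iff.1 hE0
    rw [Submodule.eq_bot_iff]
    intro α _
    funext x
    refine ContinuousLinearMap.ext fun v ↦ ?_
    have hv : v = 0 := Subsingleton.elim (α := E) v 0
    rw [hv, map_zero]
    simp
  -- recharting over `ℝ^m`, `m = dim E`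
  set m : ℕ := Module.finrank ℝ E with hm
  have hdim : Module.finrank ℝ (EuclideanSpace ℝ (Fin m)) = Module.finrank ℝ E := by simp [hm]
  set e : E ≃L[ℝ] EuclideanSpace ℝ (Fin m) := ContinuousLinearEquiv.ofFinrankEq hdim.symm with he
  haveI : IsManifold I 1 X := IsManifold.of_le (n := ∞) (by norm_num)
  set Φ : Diffeomorph 𝓘(ℝ, EuclideanSpace ℝ (Fin m)) I (Literature.Geometry.Manifold.ExtRechart I e X) X ∞ :=
    Literature.Geometry.Manifold.ExtRechart.toOrig with hΦdef
  obtain ⟨hN, hΦ⟩ := exists_contMDiffRiemannianMetric_isIsometry Φ hdim h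
  haveI : Fact ((1 : ℕ∞ω) ≤ ((⊤ : ℕ∞) : ℕ∞ω)) := ⟨by exact_mod_cast le_top⟩
  haveI : CompleteSpace (EuclideanSpace ℝ (Fin m)) := inferInstance
  haveI : (ofRiemannian hN).HasLeviCivita := PseudoRiemannianMetric.hasLeviCivita _
  have hcN : IsGeodesicallyComplete (ofRiemannian hN).leviCivita := hΦ.isGeodesicallyComplete hdim hc
  have hSN : HasSobolevInequality hN p μ := hΦ.hasSobolevInequality hS
  have hRicN : (∫⁻ u, ENNReal.ofReal (((ofRiemannian hN).normSq u ((ofRiemannian hN).ricci u)) ^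
      (p / 4)) ∂riemannianMeasure hN) ^ (2 / p) ≤ ENNReal.ofReal (μ / 16) := by
    rw [hΦ.lintegral_normSq_ricci_rpow_comp hdim p]
    exact hRic
  have hbotN : l2HarmonicOneForms hN = ⊥ :=
    l2HarmonicOneForms_eq_bot_of_small_ricci (J := 𝓘(ℝ, EuclideanSpace ℝ (Fin m))) hN hp hμ hcN
      hSN hRicN
  exact hΦ.l2HarmonicOneForms_eq_bot hdim hbotN

end VanishingBoundaryless

end Literature.Geometry.Riemannian

end
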